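import Literature.Geometry.Lorentzian.MassCapacityHarmonic
import Literature.Geometry.Lorentzian.EndFluxFormula
import HarnessLib

/-!
# The capacity and the monopole coefficient of the harmonic potential:
# `ℰ(Σ, g) = 2c` for `φ₀ = 1 - c/|x| + O₁(|x|⁻²)` (Bray 2001, §6, (87))

Third companion file of `MassCapacity.lean` (after `MassCapacityProofs.lean` and
`MassCapacityHarmonic.lean`) on the discharge path of the named fact
`Bray2001_mass_ge_half_capacity` (Bray, J. Differential Geom. 59 (2001), Thm. 9: `m ≥ ½ ℰ(Σ, g)`).
Bray, §6, (86)–(87): the capacity `ℰ(Σ, g)` of Def. 17 is attained by the Green's function `φ`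
(`Δφ = 0` outside `Σ`, `φ = 0` on `Σ`, `φ → 1`), *"and that `φ(x) = 1 − ℰ(Σ, g)/(2|x|) +
O(1/|x|²)`"* — so that `½ ℰ(Σ, g)` is the monopole coefficient `c` of the potential, the quantity
which the reflection argument (Thm. 8, the positive mass theorem for the doubled manifold) then
compares with the mass. `MassCapacityHarmonic.lean` proved the first half
(`horizonCapacity_eq_of_harmonic`: `ℰ = (1/2π) ∫_U |∇φ₀|²` for a harmonic test function `φ₀`).
This file proves the second half, **`(1/2π) ∫_U |∇φ₀|² = 2c`**, i.e. `∫_U |∇φ₀|² = 4πc`, for a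
potential with `φ₀ ∘ Φ = 1 − c/r + O₁(r⁻²)` in the chart of the end — again **without boundary
integrals** (neither at `Σ` nor at infinity):

* `AFEnd.tendsto_integral_innerDual_radialCutoff_of_expansion` — **the flux of `dv` through
  large coordinate spheres**: for `v ∈ C²(X)` with `‖D(v ∘ Φ − (c + A/r))‖ = O(r⁻³)` on an end
  with `h − δ = O(r^{−α})`, `α > 0`, and the radial cut-offs `χ_ρ = χ(‖coord‖/ρ)` of
  `EndFluxCutoff.lean`, `∫_X h⁻¹(dχ_ρ, dv) dV_h → 4πA` (`ρ → ∞`). This is the boundary-free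
  core of the flux formula `∫ Δ_h v = −4πA` of `EndFluxFormula.lean` (Schoen–Yau 1979, (3.16)),
  extracted without the one-end and `Δ_h v ∈ L¹` hypotheses used there for Green's identity: the
  chart expression of the integrand is the model `χ'(r/ρ) ρ⁻¹ (−A/r²)` (integral `4πA`) plus an
  error `O(η + 1/ρ)` on the annulus `ρ ≤ r ≤ 2ρ` (`EndFluxEstimates.lean`).
* `setIntegral_gradNorm_sq_eq_of_harmonic_of_expansion` — **`∫_U |∇φ₀|²_h dV_h = 4πc`**: for
  `ρ` large, `1 − χ_ρ` is a smooth comparison function of the capacity (supported in the closed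
  far piece `{ρ ≤ ‖coord‖} ⊆ U`, equal to `1` on `far (2ρ)`), so by
  `integral_pairing_eq_setIntegral_of_harmonic` (`MassCapacityHarmonic.lean`) its pairing with
  `φ₀` is `∫_U |∇φ₀|²`; the pairing equals `−∫ h⁻¹(dχ_ρ, df)` for the globalisation
  `f = S(‖coord‖ − R₁) · φ₀ ∈ C^∞(X)` of `φ₀` along the end (which inherits the expansion), and
  the flux lemma gives the limit `−4π(−c)`.
* `horizonCapacity_eq_ofReal_of_harmonic_of_expansion` (**`ℰ(Σ, g) = 2c`**) and
  `horizonCapacity_toReal_div_two_eq_of_harmonic_of_expansion` (**`½ ℰ(Σ, g) = c ≥ 0`**, the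
  left-hand side of Thm. 9 as it appears in `Bray2001_mass_ge_half_capacity`).

Everything is proved; there are no definitions and no named facts. Existence of the potential
and its expansion (Bray: spherical harmonics on the harmonically flat end, (10) and (87)) are
hypotheses, not assertions.

## References

* H. L. Bray, *Proof of the Riemannian Penrose inequality using the positive mass theorem*,
  J. Differential Geom. 59 (2001) 177–267 (arXiv:math/9911173), §6, Def. 17, (86)–(87), Thms. 8–9
  (key `BrayRPI2001`).
* R. Schoen, S.-T. Yau, *On the proof of the positive mass conjecture in general relativity*,
  Comm. Math. Phys. 65 (1979) 45–76, Lemma 3.2, (3.16) (key `SchoenYauPMT1979`).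
* R. Bartnik, *The mass of an asymptotically flat manifold*, CPAM 39 (1986), §4 (flux integrals
  over large coordinate spheres).
-/

noncomputable section

open Set Function Filter Metric MeasureTheory Measure TopologicalSpace Bornology Asymptotics Manifold
  Bundle
open scoped Topology RealInnerProductSpace Matrix ENNReal Manifold ContDiff

namespace Literature.Geometry.Lorentzian

namespace AFEnd

variable {X : Type} [TopologicalSpace X] [ChartedSpace E3 X] [IsManifold (𝓡 3) ∞ X]
  [T2Space X] [LocallyCompactSpace X] [SigmaCompactSpace X] [MeasurableSpace X] [BorelSpace X]
  (e : AFEnd X) (D : InitialDataSet (𝓡 3) X) [D.metric.HasLeviCivita]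

/-- **The flux of `dv` through large coordinate spheres, for `v = c + A/r + O₁(r⁻²)`.** Let the
end `e` of the `3`-manifold `(X, h)` be asymptotically flat of some order `α > 0` in the metric
(`h − δ = O(r^{−α})`), let `v ∈ C²(X)` satisfy `‖D(v ∘ Φ − (c + A/r))(z)‖ = O(‖z‖⁻³)` in the
chart of the end, and let `χ_ρ(q) = χ(‖coord q‖/ρ)` be the radial cut-offs of a smooth profile
`χ` (`= 1` on `(−∞, 1]`, `= 0` on `[2, ∞)`). Then
`∫_X h⁻¹(dχ_ρ, dv) dV_h → 4πA` as `ρ → ∞`.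
This is the boundary-free part of the flux computation of `EndFluxFormula.lean`
(`AFEnd.integral_dalembertian_eq_of_expansion`, Schoen–Yau 1979, (3.16)): read in the chart of
the end, the integrand is the model `χ'(r/ρ) ρ⁻¹ (−A/r²)` — whose integral is `4πA` exactly —
plus an error of size `(9η C_V C₁/ρ² + 3 C_ω C₁/ρ³)/ρ` on the annulus `ρ ≤ r ≤ 2ρ`, whose
integral tends to `0`. No hypothesis on the other ends of `X` (nor on `Δ_h v`) is needed.
[cite: SchoenYauPMT1979, Lemma 3.2 (3.16)] -/
theorem tendsto_integral_innerDual_radialCutoff_of_expansion {α : ℝ} (hα : 0 < α)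
    (hAF : e.IsMetricAsymptoticallyFlat D α) {v : X → ℝ} (hv : ContMDiff (𝓡 3) 𝓘(ℝ, ℝ) 2 v)
    {c A : ℝ}
    (hexp : (fun x : E3 ↦ ‖fderiv ℝ (fun y ↦ endValue e v y - (c + A / ‖y‖)) x‖) =O[cobounded E3]
      fun x ↦ ‖x‖ ^ (-3 : ℝ))
    {χ : ℝ → ℝ} (hχ : ContDiff ℝ ∞ χ) (h1 : ∀ s, s ≤ 1 → χ s = 1) (h2 : ∀ s, 2 ≤ s → χ s = 0) :
    Tendsto (fun ρ : ℝ ↦ ∫ x, D.metric.innerDual x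
        (mvfderiv (𝓡 3) (fun q ↦ χ (‖e.coord q‖ / ρ)) x).toLinearMap
        (mvfderiv (𝓡 3) v x).toLinearMap ∂riemannianMeasure D.h) atTop
      (𝓝 (4 * Real.pi * A)) := by
  classical
  set μ : Measure X := riemannianMeasure D.h with hμ
  -- notation in the chart: `H`, its inverse, the density, `V = v ∘ Φ`, the model `V⁰`
  set H : E3 → Matrix (Fin 3) (Fin 3) ℝ := fun z ↦ Matrix.of fun i j ↦
    hCoeff e D z (EuclideanSpace.single i 1) (EuclideanSpace.single j 1) with hHdef
  set dens : E3 → ℝ := fun z ↦ Real.sqrt (H z).det with hdens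
  set V : E3 → ℝ := endValue e v with hVdef
  set V₀ : E3 → ℝ := fun y ↦ c + A / ‖y‖ with hV₀
  -- (0) the constants of the profile
  obtain ⟨C₁, hC₁, hdχ⟩ := exists_bound_deriv_radialProfile hχ h1 h2
  -- (1) the constant and radius of the expansion
  obtain ⟨Cω', hCω'0, hCω'⟩ := hexp.exists_nonneg
  set Cω : ℝ := Cω' with hCωdef
  obtain ⟨R₂', -, hR₂'⟩ := (hasBasis_cobounded_norm (E := E3)).eventually_iff.1 hCω'.bound
  set R₂ : ℝ := max (max R₂' 1) (e.R + 1) with hR₂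
  have hR₂1 : 1 ≤ R₂ := (le_max_right _ _).trans (le_max_left _ _)
  have hRR₂ : e.R < R₂ := by
    have : e.R + 1 ≤ R₂ := le_max_right _ _
    linarith
  have hω : ∀ z : E3, R₂ ≤ ‖z‖ → ‖fderiv ℝ (fun y ↦ V y - V₀ y) z‖ ≤ Cω / ‖z‖ ^ 3 := by
    intro z hz
    have hz1 : 1 ≤ ‖z‖ := hR₂1.trans hz
    have hzR : R₂' ≤ ‖z‖ := ((le_max_left _ _).trans (le_max_left _ _)).trans hz
    have h := hR₂' (show z ∈ {x | R₂' ≤ ‖x‖} from hzR)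
    simp only [norm_norm] at h
    rw [Real.norm_of_nonneg (Real.rpow_nonneg (norm_nonneg _) _), Real.rpow_neg (norm_nonneg _),
      show ((3 : ℝ)) = ((3 : ℕ) : ℝ) by norm_num, Real.rpow_natCast] at h
    rw [div_eq_mul_inv]
    exact h
  set CV : ℝ := |A| + Cω with hCVdef
  have hCV0 : 0 ≤ CV := by positivity
  -- (2) derivatives of `V` in the chart: `|∂ₖV| ≤ C_V/r²`, `|∂ₖV − g⁰ₖ| ≤ C_ω/r³`
  have hVd : ∀ z : E3, e.R < ‖z‖ → DifferentiableAt ℝ V z := fun z hz ↦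
    e.differentiableAt_endValue ⟨z, hz⟩ ((hv _).mdifferentiableAt (by simp))
  have hgrad : ∀ z : E3, R₂ ≤ ‖z‖ → ∀ k : Fin 3,
      |fderiv ℝ V z (EuclideanSpace.single k 1) - (-A * z k / ‖z‖ ^ 3)| ≤ Cω / ‖z‖ ^ 3 ∧
      |fderiv ℝ V z (EuclideanSpace.single k 1)| ≤ CV / ‖z‖ ^ 2 := by
    intro z hz k
    have hz0 : z ≠ 0 := by
      rintro rfl
      simp at hz
      linarith
    have hzn : 0 < ‖z‖ := norm_pos_iff.2 hz0
    have hz1 : 1 ≤ ‖z‖ := hR₂1.trans hz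
    have hzR : e.R < ‖z‖ := hRR₂.trans_le hz
    have hV₀d : DifferentiableAt ℝ V₀ z :=
      (((hasFDerivAt_inv_norm hz0).const_mul A).const_add c).differentiableAt.congr_of_eventuallyEq
        (Eventually.of_forall fun y ↦ by simp [hV₀, div_eq_mul_inv])
    have hsub : fderiv ℝ (fun y ↦ V y - V₀ y) z = fderiv ℝ V z - fderiv ℝ V₀ z :=
      fderiv_sub (hVd z hzR) hV₀d
    have hg0 : fderiv ℝ V₀ z (EuclideanSpace.single k 1) = -A * z k / ‖z‖ ^ 3 :=
      fderiv_const_add_div_norm_apply c A hz0 k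
    have hek : ‖(EuclideanSpace.single k (1 : ℝ) : E3)‖ = 1 := by simp
    have hdiff : |fderiv ℝ V z (EuclideanSpace.single k 1) - (-A * z k / ‖z‖ ^ 3)| ≤ Cω / ‖z‖ ^ 3 := by
      have heq : fderiv ℝ V z (EuclideanSpace.single k 1) - (-A * z k / ‖z‖ ^ 3) =
          fderiv ℝ (fun y ↦ V y - V₀ y) z (EuclideanSpace.single k 1) := by
        rw [hsub, ← hg0]
        rfl
      rw [heq, ← Real.norm_eq_abs]
      calc ‖fderiv ℝ (fun y ↦ V y - V₀ y) z (EuclideanSpace.single k 1)‖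
          ≤ ‖fderiv ℝ (fun y ↦ V y - V₀ y) z‖ * ‖(EuclideanSpace.single k (1 : ℝ) : E3)‖ :=
            ContinuousLinearMap.le_opNorm _ _
        _ ≤ Cω / ‖z‖ ^ 3 := by
            rw [hek, mul_one]
            exact hω z hz
    refine ⟨hdiff, ?_⟩
    have hmod := abs_modelGradient_le A hz0 k
    have htri := abs_sub_abs_le_abs_sub (fderiv ℝ V z (EuclideanSpace.single k 1))
      (-A * z k / ‖z‖ ^ 3)
    have h3 : Cω / ‖z‖ ^ 3 ≤ Cω / ‖z‖ ^ 2 := by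
      apply div_le_div_of_nonneg_left hCω'0 (by positivity)
      nlinarith
    calc |fderiv ℝ V z (EuclideanSpace.single k 1)|
        ≤ |(-A * z k / ‖z‖ ^ 3)| + Cω / ‖z‖ ^ 3 := by linarith
      _ ≤ |A| / ‖z‖ ^ 2 + Cω / ‖z‖ ^ 2 := add_le_add hmod h3
      _ = CV / ‖z‖ ^ 2 := by rw [hCVdef, add_div]
  -- (5) the right-hand side in the chart of the end
  -- the chart integrand `F_ρ` and the model integrand `M_ρ`
  set F : ℝ → E3 → ℝ := fun ρ z ↦ (∑ l, ∑ k, (H z)⁻¹ k l * fderiv ℝ V z (EuclideanSpace.single k 1) *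
    fderiv ℝ (fun y : E3 ↦ χ (‖y‖ / ρ)) z (EuclideanSpace.single l 1)) * dens z with hFdef
  set M : ℝ → E3 → ℝ := fun ρ z ↦ deriv χ (‖z‖ / ρ) / ρ * (-A / ‖z‖ ^ 2) with hMdef
  have hRHS : ∀ ρ : ℝ, R₂ < ρ →
      ∫ x, D.metric.innerDual x (mvfderiv (𝓡 3) (fun q ↦ χ (‖e.coord q‖ / ρ)) x).toLinearMap
          (mvfderiv (𝓡 3) v x).toLinearMap ∂μ = ∫ z in {z : E3 | R₂ < ‖z‖}, F ρ z := by
    intro ρ hρ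
    have hρR : e.R < ρ := hRR₂.trans hρ
    -- the integrand is supported in `far R₂`
    have hsupp : support (fun x ↦ D.metric.innerDual x
        (mvfderiv (𝓡 3) (fun q ↦ χ (‖e.coord q‖ / ρ)) x).toLinearMap
        (mvfderiv (𝓡 3) v x).toLinearMap) ⊆ e.far R₂ := by
      intro x hx
      rw [mem_support] at hx
      by_contra hfar
      apply hx
      rw [e.mvfderiv_radialCutoff_eq_zero h1 hρR (e.not_mem_closedFar_of_not_mem_far hρ hfar)]
      simp [PseudoRiemannianMetric.innerDual]
    rw [e.integral_eq_setIntegral_far D hRR₂.le hsupp]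
    refine setIntegral_congr_fun (isOpen_lt continuous_const continuous_norm).measurableSet
      fun z hz ↦ ?_
    have hzR : e.R < ‖z‖ := hRR₂.trans hz
    rw [e.dataChartExt_of_lt hzR,
      e.innerDual_mvfderiv_dataChart D ⟨z, hzR⟩
        ((e.contMDiff_radialCutoff hχ h1 hρR _).mdifferentiableAt (by simp))
        ((hv _).mdifferentiableAt (by simp))]
    -- the chart representative of `χ_ρ` near `z`
    have hev : endValue e (fun q ↦ χ (‖e.coord q‖ / ρ)) =ᶠ[𝓝 z] fun y : E3 ↦ χ (‖y‖ / ρ) := by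
      filter_upwards [(isOpen_lt continuous_const continuous_norm).mem_nhds hzR] with y hy
      exact e.endValue_radialCutoff ρ hy
    simp only [hFdef, hHdef, hdens, hVdef, hev.fderiv_eq]
  -- (6) pointwise: `F_ρ = M_ρ` off the annulus, and the error bound on it
  have hF0 : ∀ ρ : ℝ, R₂ < ρ → ∀ z : E3, (‖z‖ < ρ ∨ 2 * ρ < ‖z‖) → F ρ z = 0 := by
    intro ρ hρ z hz
    have hρ0 : 0 < ρ := by linarith
    simp [hFdef, fderiv_radialProfile_norm_div_eq_zero h1 h2 hρ0 hz]
  have hM0 : ∀ ρ : ℝ, R₂ < ρ → ∀ z : E3, (‖z‖ < ρ ∨ 2 * ρ < ‖z‖) → M ρ z = 0 := by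
    intro ρ hρ z hz
    have hρ0 : 0 < ρ := by linarith
    simp only [hMdef]
    rcases hz with hz | hz
    · rw [deriv_radialProfile_eq_zero_of_lt_one h1 ((div_lt_one hρ0).2 hz)]
      simp
    · rw [deriv_radialProfile_eq_zero_of_two_lt h2 ((lt_div_iff₀ hρ0).2 (by linarith))]
      simp
  have hErr : ∀ {η : ℝ}, 0 < η → ∀ {ρ₀ : ℝ}, (∀ z : E3, ρ₀ ≤ ‖z‖ → ∀ k l,
      |(H z)⁻¹ k l * dens z - (1 : Matrix (Fin 3) (Fin 3) ℝ) k l| ≤ η) →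
      ∀ ρ : ℝ, R₂ < ρ → ρ₀ ≤ ρ → ∀ z : E3, R₂ < ‖z‖ →
        |F ρ z - M ρ z| ≤ (9 * η * CV * C₁ / ρ ^ 2 + 3 * Cω * C₁ / ρ ^ 3) / ρ := by
    intro η hη ρ₀ hW ρ hρ hρ₀ z hz
    have hρ0 : 0 < ρ := by linarith
    have hρ1 : 1 ≤ ρ := hR₂1.trans hρ.le
    by_cases hann : ‖z‖ < ρ ∨ 2 * ρ < ‖z‖
    · rw [hF0 ρ hρ z hann, hM0 ρ hρ z hann, sub_zero, abs_zero]
      positivity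
    push Not at hann
    obtain ⟨hzρ, hz2ρ⟩ := hann
    have hz0 : z ≠ 0 := by
      rintro rfl
      simp at hzρ
      linarith
    have hzn : 0 < ‖z‖ := norm_pos_iff.2 hz0
    -- rewrite both terms as sums over the same data
    have hFz : F ρ z = ∑ l, ∑ k, ((H z)⁻¹ k l * dens z) * fderiv ℝ V z (EuclideanSpace.single k 1) *
        fderiv ℝ (fun y : E3 ↦ χ (‖y‖ / ρ)) z (EuclideanSpace.single l 1) := by
      simp only [hFdef, Finset.sum_mul]
      refine Finset.sum_congr rfl fun l _ ↦ Finset.sum_congr rfl fun k _ ↦ ?_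
      ring
    have hMz : M ρ z = ∑ k, (-A * z k / ‖z‖ ^ 3) *
        fderiv ℝ (fun y : E3 ↦ χ (‖y‖ / ρ)) z (EuclideanSpace.single k 1) := by
      rw [sum_modelGradient_mul_fderiv_radialProfile hχ ρ A hz0]
    rw [hFz, hMz]
    have hkey := abs_fluxSum_sub_modelSum_le (W := Matrix.of fun k l ↦ (H z)⁻¹ k l * dens z)
      (dV := fun k ↦ fderiv ℝ V z (EuclideanSpace.single k 1))
      (g := fun k ↦ -A * z k / ‖z‖ ^ 3)
      (dχ := fun l ↦ fderiv ℝ (fun y : E3 ↦ χ (‖y‖ / ρ)) z (EuclideanSpace.single l 1))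
      hη.le hCV0 hCω'0 hzn
      (fun k l ↦ by simpa only [Matrix.of_apply] using hW z (hρ₀.trans hzρ) k l)
      (fun k ↦ (hgrad z hz.le k).2) (fun k ↦ (hgrad z hz.le k).1)
      (fun l ↦ by
        have h := (fderiv ℝ (fun y : E3 ↦ χ (‖y‖ / ρ)) z).le_opNorm (EuclideanSpace.single l 1)
        have hel : ‖(EuclideanSpace.single l (1 : ℝ) : E3)‖ = 1 := by simp
        rw [hel, mul_one, Real.norm_eq_abs] at h
        exact h.trans (norm_fderiv_radialProfile_norm_div_le hχ h1 hC₁ hdχ hρ0 z))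
    simp only [Matrix.of_apply] at hkey
    refine hkey.trans ?_
    -- `r ≥ ρ`: replace `r` by `ρ` in the bound
    have hA1 : 9 * η * CV * C₁ / ‖z‖ ^ 2 ≤ 9 * η * CV * C₁ / ρ ^ 2 :=
      div_le_div_of_nonneg_left (by positivity) (by positivity) (by nlinarith)
    have hA2 : 3 * Cω * C₁ / ‖z‖ ^ 3 ≤ 3 * Cω * C₁ / ρ ^ 3 :=
      div_le_div_of_nonneg_left (by positivity) (by positivity)
        (pow_le_pow_left₀ hρ0.le hzρ 3)
    exact div_le_div_of_nonneg_right (add_le_add hA1 hA2) hρ0.le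
  -- (7) continuity of `F_ρ` on the exterior region and of `M_ρ` everywhere; integrability
  have hVC2 : ContDiffOn ℝ 2 V {z | e.R < ‖z‖} := e.contDiffOn_endValue_of_contMDiff (n := 2) hv
  have hFc : ∀ ρ : ℝ, 0 < ρ → ContinuousOn (F ρ) {z | e.R < ‖z‖} := by
    intro ρ hρ
    have hopen : IsOpen {z : E3 | e.R < ‖z‖} := isOpen_lt continuous_const continuous_norm
    have hdV : ∀ k, ContinuousOn (fun z ↦ fderiv ℝ V z (EuclideanSpace.single k 1)) {z | e.R < ‖z‖} :=
      fun k ↦ (hVC2.continuousOn_fderiv_of_isOpen hopen (by norm_num)).clm_apply continuousOn_const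
    have hdχc : ∀ l, Continuous fun z ↦ fderiv ℝ (fun y : E3 ↦ χ (‖y‖ / ρ)) z (EuclideanSpace.single l 1) :=
      fun l ↦ ((contDiff_radialProfile_norm_div hχ h1 hρ).continuous_fderiv (by simp)).clm_apply
        continuous_const
    have hHc : ContinuousOn H {z | e.R < ‖z‖} := by
      refine continuousOn_pi.2 fun i ↦ continuousOn_pi.2 fun j ↦ ?_
      exact ((ContinuousLinearMap.apply ℝ ℝ (EuclideanSpace.single j 1)).continuous.comp
        (ContinuousLinearMap.apply ℝ (E3 →L[ℝ] ℝ) (EuclideanSpace.single i 1)).continuous)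
        |>.comp_continuousOn (e.continuousOn_hCoeff D)
    have hdensc : ContinuousOn dens {z | e.R < ‖z‖} :=
      Real.continuous_sqrt.comp_continuousOn (continuous_id.matrix_det.comp_continuousOn hHc)
    refine ContinuousOn.mul ?_ hdensc
    refine continuousOn_finsetSum _ fun l _ ↦ continuousOn_finsetSum _ fun k _ ↦ ?_
    exact ((e.continuousOn_gram_hCoeff_inv D k l).mul (hdV k)).mul (hdχc l).continuousOn
  have hMc : ∀ ρ : ℝ, R₂ < ρ → Continuous (M ρ) := by
    intro ρ hρ
    have hρ0 : 0 < ρ := by linarith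
    rw [continuous_iff_continuousAt]
    intro z
    by_cases hz : ‖z‖ < ρ
    · have hev : M ρ =ᶠ[𝓝 z] fun _ ↦ 0 := by
        filter_upwards [(isOpen_lt continuous_norm continuous_const).mem_nhds hz] with y hy
        exact hM0 ρ hρ y (Or.inl hy)
      exact continuousAt_const.congr_of_eventuallyEq hev
    · have hz0 : z ≠ 0 := by
        rintro rfl
        simp at hz
        linarith
      have h1c : ContinuousAt (fun z : E3 ↦ deriv χ (‖z‖ / ρ) / ρ) z :=
        (((hχ.continuous_deriv (by simp)).comp (continuous_norm.div_const ρ)).div_const ρ).continuousAt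
      have h2c : ContinuousAt (fun z : E3 ↦ -A / ‖z‖ ^ 2) z :=
        continuousAt_const.div ((continuous_norm.pow 2).continuousAt)
          (pow_ne_zero 2 (norm_ne_zero_iff.2 hz0))
      exact h1c.mul h2c
  have hMint : ∀ ρ : ℝ, R₂ < ρ → Integrable (M ρ) (volume : Measure E3) := by
    intro ρ hρ
    refine (hMc ρ hρ).integrable_of_hasCompactSupport
      (HasCompactSupport.intro' (isCompact_closedBall (0 : E3) (2 * ρ)) isClosed_closedBall
        fun z hz ↦ hM0 ρ hρ z (Or.inr ?_))
    rw [mem_closedBall_zero_iff, not_le] at hz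
    exact hz
  have hFint : ∀ ρ : ℝ, R₂ < ρ → IntegrableOn (F ρ) {z : E3 | R₂ < ‖z‖} volume := by
    intro ρ hρ
    have hρ0 : 0 < ρ := by linarith
    -- integrable on the compact annulus `R₂ ≤ ‖z‖ ≤ 2ρ`, zero on the rest
    set K : Set E3 := {z | R₂ ≤ ‖z‖ ∧ ‖z‖ ≤ 2 * ρ} with hK
    have hKc : IsCompact K := by
      have : K = closedBall (0 : E3) (2 * ρ) ∩ {z | R₂ ≤ ‖z‖} := by
        ext z
        simp only [hK, mem_setOf_eq, mem_inter_iff, mem_closedBall_zero_iff]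
        tauto
      rw [this]
      exact (isCompact_closedBall _ _).inter_right (isClosed_le continuous_const continuous_norm)
    have hKsub : K ⊆ {z | e.R < ‖z‖} := fun z hz ↦ hRR₂.trans_le hz.1
    have hIK : IntegrableOn (F ρ) K volume := ((hFc ρ hρ0).mono hKsub).integrableOn_compact hKc
    have hs : {z : E3 | R₂ < ‖z‖} ⊆ K ∪ {z : E3 | 2 * ρ < ‖z‖} := by
      intro z hz
      by_cases h : ‖z‖ ≤ 2 * ρ
      · exact Or.inl ⟨le_of_lt hz, h⟩
      · exact Or.inr (not_le.1 h)
    refine IntegrableOn.mono_set ?_ hs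
    refine hIK.union ?_
    refine (integrableOn_zero).congr_fun (fun z hz ↦ (hF0 ρ hρ z (Or.inr hz)).symm)
      (isOpen_lt continuous_const continuous_norm).measurableSet
  -- (8) the chart integral: `∫ F_ρ = 4πA + ∫ (F_ρ − M_ρ)` with the error bound
  have hsplit : ∀ {η : ℝ}, 0 < η → ∀ {ρ₀ : ℝ}, (∀ z : E3, ρ₀ ≤ ‖z‖ → ∀ k l,
      |(H z)⁻¹ k l * dens z - (1 : Matrix (Fin 3) (Fin 3) ℝ) k l| ≤ η) →
      ∀ ρ : ℝ, R₂ < ρ → ρ₀ ≤ ρ →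
        |(∫ z in {z : E3 | R₂ < ‖z‖}, F ρ z) - 4 * Real.pi * A| ≤
          (32 * Real.pi / 3) * (9 * η * CV * C₁ + 3 * Cω * C₁ / ρ) := by
    intro η hη ρ₀ hW ρ hρ hρ₀
    have hρ0 : 0 < ρ := by linarith
    have hs : MeasurableSet {z : E3 | R₂ < ‖z‖} :=
      (isOpen_lt continuous_const continuous_norm).measurableSet
    -- `∫_{R₂ < ‖z‖} M_ρ = ∫ M_ρ = 4πA`
    have hMI : ∫ z in {z : E3 | R₂ < ‖z‖}, M ρ z = 4 * Real.pi * A := by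
      rw [setIntegral_eq_integral_of_forall_compl_eq_zero fun z hz ↦ hM0 ρ hρ z (Or.inl ?_)]
      · exact integral_radialMainTerm hχ h1 h2 hρ0 A
      · simp only [mem_setOf_eq, not_lt] at hz
        exact lt_of_le_of_lt hz hρ
    have hEI : (∫ z in {z : E3 | R₂ < ‖z‖}, F ρ z) - 4 * Real.pi * A =
        ∫ z in {z : E3 | R₂ < ‖z‖}, (F ρ z - M ρ z) := by
      rw [integral_sub (hFint ρ hρ) (hMint ρ hρ).integrableOn, hMI]
    rw [hEI]
    -- the error is supported in the ball of radius `2ρ` and bounded there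
    set s' : Set E3 := {z : E3 | R₂ < ‖z‖} ∩ closedBall 0 (2 * ρ) with hs'
    have hs'm : MeasurableSet s' := hs.inter measurableSet_closedBall
    have hzero : ∀ z ∈ {z : E3 | R₂ < ‖z‖} \ s', F ρ z - M ρ z = 0 := by
      intro z hz
      have hz2 : 2 * ρ < ‖z‖ := by
        have : z ∉ closedBall (0 : E3) (2 * ρ) := fun h ↦ hz.2 ⟨hz.1, h⟩
        rwa [mem_closedBall_zero_iff, not_le] at this
      rw [hF0 ρ hρ z (Or.inr hz2), hM0 ρ hρ z (Or.inr hz2), sub_zero]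
    rw [setIntegral_eq_of_subset_of_forall_sdiff_eq_zero hs inter_subset_left hzero]
    have hfin : volume s' < ⊤ :=
      (measure_mono inter_subset_right).trans_lt (isCompact_closedBall _ _).measure_lt_top
    have hbound : ∀ z ∈ s', ‖F ρ z - M ρ z‖ ≤ (9 * η * CV * C₁ / ρ ^ 2 + 3 * Cω * C₁ / ρ ^ 3) / ρ :=
      fun z hz ↦ by
        rw [Real.norm_eq_abs]
        exact hErr hη hW ρ hρ hρ₀ z hz.1
    have hI := norm_setIntegral_le_of_norm_le_const hfin hbound
    rw [Real.norm_eq_abs] at hI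
    refine hI.trans ?_
    have hvol : (volume : Measure E3).real s' ≤ (2 * ρ) ^ 3 * (Real.pi * 4 / 3) := by
      have h1 : (volume : Measure E3).real s' ≤ (volume : Measure E3).real (closedBall 0 (2 * ρ)) :=
        measureReal_mono inter_subset_right (isCompact_closedBall _ _).measure_lt_top.ne
      refine h1.trans (le_of_eq ?_)
      rw [measureReal_def, EuclideanSpace.volume_closedBall_fin_three, ENNReal.toReal_mul,
        ← ENNReal.ofReal_pow (by positivity), ENNReal.toReal_ofReal (by positivity),
        ENNReal.toReal_ofReal (by positivity)]
    have hnn : 0 ≤ (9 * η * CV * C₁ / ρ ^ 2 + 3 * Cω * C₁ / ρ ^ 3) / ρ := by positivity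
    calc (9 * η * CV * C₁ / ρ ^ 2 + 3 * Cω * C₁ / ρ ^ 3) / ρ * (volume : Measure E3).real s'
        ≤ (9 * η * CV * C₁ / ρ ^ 2 + 3 * Cω * C₁ / ρ ^ 3) / ρ * ((2 * ρ) ^ 3 * (Real.pi * 4 / 3)) :=
          mul_le_mul_of_nonneg_left hvol hnn
      _ = (32 * Real.pi / 3) * (9 * η * CV * C₁ + 3 * Cω * C₁ / ρ) := by
          field_simp
          ring
  -- (9) conclusion: for `ε > 0`, eventually `|∫ F_ρ − 4πA| ≤ ε/2 < ε`
  rw [Metric.tendsto_nhds]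
  intro ε hε
  set η : ℝ := ε / (4 * ((32 * Real.pi / 3) * (9 * CV * C₁) + 1)) with hηdef
  have hη : 0 < η := by positivity
  obtain ⟨ρ₀, hW⟩ := e.exists_radius_abs_gramInvSqrtDet_sub_one_le D hα hAF hη
  have hev2 : ∀ᶠ ρ : ℝ in atTop, (32 * Real.pi / 3) * (9 * η * CV * C₁ + 3 * Cω * C₁ / ρ) ≤ ε / 2 := by
    have ht : Tendsto (fun ρ : ℝ ↦ (32 * Real.pi / 3) * (9 * η * CV * C₁ + 3 * Cω * C₁ / ρ)) atTop
        (𝓝 ((32 * Real.pi / 3) * (9 * η * CV * C₁ + 0))) := by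
      refine Tendsto.const_mul _ (tendsto_const_nhds.add ?_)
      simpa using (tendsto_const_nhds (x := 3 * Cω * C₁)).div_atTop tendsto_id
    have hlt : (32 * Real.pi / 3) * (9 * η * CV * C₁ + 0) < ε / 2 := by
      rw [add_zero, hηdef]
      have hpos : 0 < (32 * Real.pi / 3) * (9 * CV * C₁) + 1 := by positivity
      have h1 : (32 * Real.pi / 3) * (9 * (ε / (4 * ((32 * Real.pi / 3) * (9 * CV * C₁) + 1))) *
          CV * C₁) = (ε / 4) * (((32 * Real.pi / 3) * (9 * CV * C₁)) /
            ((32 * Real.pi / 3) * (9 * CV * C₁) + 1)) := by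
        field_simp
      rw [h1]
      have h2 : ((32 * Real.pi / 3) * (9 * CV * C₁)) / ((32 * Real.pi / 3) * (9 * CV * C₁) + 1) < 1 :=
        (div_lt_one hpos).2 (by linarith)
      have h3 : 0 ≤ ((32 * Real.pi / 3) * (9 * CV * C₁)) / ((32 * Real.pi / 3) * (9 * CV * C₁) + 1) :=
        by positivity
      nlinarith
    exact (ht.eventually (Iic_mem_nhds hlt)).mono fun ρ hρ ↦ hρ
  filter_upwards [hev2, eventually_gt_atTop R₂, eventually_ge_atTop ρ₀] with ρ hρ2 hρR hρ₀
  rw [hRHS ρ hρR, Real.dist_eq]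
  exact ((hsplit hη hW ρ hρR hρ₀).trans hρ2).trans_lt (half_lt_self hε)

end AFEnd

/-! ## `ℰ(Σ, g) = 2c`: the capacity is twice the monopole coefficient of the potential -/

section Capacity

variable {X : Type} [TopologicalSpace X] [ChartedSpace E3 X] [IsManifold (𝓡 3) ∞ X]
  [T2Space X] [LocallyCompactSpace X] [SigmaCompactSpace X] [MeasurableSpace X] [BorelSpace X]
  {e : AFEnd X} {U : Opens X} (D : InitialDataSet (𝓡 3) X) [D.metric.HasLeviCivita]

/-- **The energy of the harmonic potential is the flux of its monopole term**:
`∫_U |∇φ₀|²_h dV_h = 4πc` for `φ₀ = 1 - c/|x| + O₁(|x|⁻²)` (Bray 2001, §6, (86)–(87): the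
Green's function has `φ = 1 - ℰ(Σ, g)/(2|x|) + O(|x|⁻²)`, "where `m` is the total mass … and
`ℰ` is the energy"). Hypotheses: the end `e` is asymptotically flat of some order `α > 0` in the
metric; `U` is an exterior region of `e`; `φ₀` is a test function of the capacity, `h`-harmonic
with `0 < φ₀ < 1` on `U` and of finite energy there (as in `horizonCapacity_eq_of_harmonic`); and
in the chart of the end `‖D(φ₀ ∘ Φ − (1 − c/r))(z)‖ = O(‖z‖⁻³)`. Proof, without boundary
integrals: for `ρ` large the function `1 − χ(‖coord‖/ρ)` (radial cut-off profile `χ`) is a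
smooth comparison function (supported in the closed far piece `{ρ ≤ ‖coord‖} ⊆ U`, equal to
`1` on `far (2ρ)`), so its pairing with `φ₀` is `∫_U |∇φ₀|²`
(`integral_pairing_eq_setIntegral_of_harmonic`); that pairing is `−∫ h⁻¹(dχ_ρ, df)` for the
globalisation `f = S(‖coord‖ − R₁) φ₀ ∈ C^∞(X)` of `φ₀` along the end, which tends to
`−4π(−c) = 4πc` (`AFEnd.tendsto_integral_innerDual_radialCutoff_of_expansion`).
[cite: BrayRPI2001, §6 (86)–(87)] -/
theorem setIntegral_gradNorm_sq_eq_of_harmonic_of_expansion {α : ℝ} (hα : 0 < α)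
    (hAF : e.IsMetricAsymptoticallyFlat D α) (hU : IsExteriorRegion e U) {φ₀ : X → ℝ}
    (hφ₀ : IsCapacityTestFn e U φ₀)
    (hΔ : ∀ x ∈ (U : Set X), D.metric.dalembertian φ₀ x = 0)
    (h01 : ∀ x ∈ (U : Set X), 0 < φ₀ x ∧ φ₀ x < 1)
    (hfin : ∫⁻ x in (U : Set X), ENNReal.ofReal (gradNorm D.h φ₀ x ^ 2) ∂riemannianMeasure D.h < ⊤)
    {c : ℝ}
    (hexp : (fun x : E3 ↦ ‖fderiv ℝ (fun y ↦ endValue e φ₀ y - (1 - c / ‖y‖)) x‖)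
      =O[cobounded E3] fun x ↦ ‖x‖ ^ (-3 : ℝ)) :
    ∫ x in (U : Set X), gradNorm D.h φ₀ x ^ 2 ∂riemannianMeasure D.h = 4 * Real.pi * c := by
  classical
  haveI : (PseudoRiemannianMetric.ofRiemannian D.h).HasLeviCivita := ‹D.metric.HasLeviCivita›
  set μ : Measure X := riemannianMeasure D.h with hμ
  obtain ⟨-, R', hR', hfarU, -⟩ := id hU
  obtain ⟨χ, hχ, h1, h2, -⟩ := exists_radialProfile
  -- (1) globalisation of `φ₀` along the end: `f = S(‖coord‖ - R₁) φ₀`, `R₁ = R' + 1`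
  set R₁ : ℝ := R' + 1 with hR₁_def
  have hR₁ : e.R < R₁ := by rw [hR₁_def]; linarith
  have hfar_sub : ((↑) : e.U → X) '' (e.chart ⁻¹' {x | R₁ ≤ ‖(x : E3)‖}) ⊆ (U : Set X) :=
    fun q hq ↦ by
      obtain ⟨hqU, hqR⟩ := e.mem_image_preimage_le_norm_iff.1 hq
      exact hfarU (e.mem_far_iff_coord.2 ⟨hqU, by rw [hR₁_def] at hqR; linarith⟩)
  set f : X → ℝ := fun q ↦ Real.smoothTransition (‖e.coord q‖ - R₁) * φ₀ q with hf_def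
  have hfs : ContMDiff (𝓡 3) 𝓘(ℝ, ℝ) ∞ f := fun q ↦ by
    by_cases hq : q ∈ ((↑) : e.U → X) '' (e.chart ⁻¹' {x | R₁ ≤ ‖(x : E3)‖})
    · exact ((e.contMDiff_endCutoff hR₁) q).mul
        (hφ₀.contMDiffOn.contMDiffAt (U.isOpen.mem_nhds (hfar_sub hq)))
    · have hev : f =ᶠ[𝓝 q] fun _ ↦ 0 := by
        filter_upwards [e.endCutoff_eventuallyEq_zero hR₁ hq] with p hp
        have hp' : Real.smoothTransition (‖e.coord p‖ - R₁) = 0 := hp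
        simp only [hf_def, hp', zero_mul]
      exact contMDiffAt_const.congr_of_eventuallyEq hev
  have hfφ : ∀ q ∈ e.far (R₁ + 1), f q = φ₀ q := fun q hq ↦ by
    obtain ⟨-, hqR⟩ := e.mem_far_iff_coord.1 hq
    simp only [hf_def, e.endCutoff_eq_one hqR.le, one_mul]
  have hfφ' : ∀ q ∈ e.far (R₁ + 1), f =ᶠ[𝓝 q] φ₀ := fun q hq ↦
    Filter.eventuallyEq_of_mem ((e.isOpen_far _).mem_nhds hq) hfφ
  -- (2) the expansion of `f` in the chart of the end
  have hexpf : (fun x : E3 ↦ ‖fderiv ℝ (fun y ↦ endValue e f y - (1 + -c / ‖y‖)) x‖)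
      =O[cobounded E3] fun x ↦ ‖x‖ ^ (-3 : ℝ) := by
    refine hexp.congr' ?_ EventuallyEq.rfl
    filter_upwards [eventually_cobounded_le_norm (E := E3) (R₁ + 2)] with x hx
    have hev : (fun y : E3 ↦ endValue e φ₀ y - (1 - c / ‖y‖)) =ᶠ[𝓝 x]
        fun y ↦ endValue e f y - (1 + -c / ‖y‖) := by
      filter_upwards [(isOpen_lt continuous_const continuous_norm).mem_nhds
        (show R₁ + 1 < ‖x‖ by linarith)] with y hy
      have hyR : e.R < ‖y‖ := by linarith
      rw [endValue_of_lt e _ hyR, endValue_of_lt e _ hyR,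
        hfφ _ (e.mem_far_iff.2 ⟨⟨y, mem_exteriorRegion.2 hyR⟩, hy, rfl⟩), neg_div,
        ← sub_eq_add_neg]
    rw [hev.fderiv_eq]
  -- (3) the flux of `df` through large coordinate spheres tends to `4π(-c)`
  have hflux := e.tendsto_integral_innerDual_radialCutoff_of_expansion D hα hAF
    (hfs.of_le (WithTop.coe_le_coe.2 le_top)) hexpf hχ h1 h2
  -- (4) for `ρ > R₁ + 1` the flux integral is `-∫_U |∇φ₀|²`
  have hconst : ∀ᶠ ρ : ℝ in atTop, ∫ x, D.metric.innerDual x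
      (mvfderiv (𝓡 3) (fun q ↦ χ (‖e.coord q‖ / ρ)) x).toLinearMap
      (mvfderiv (𝓡 3) f x).toLinearMap ∂μ =
        -∫ x in (U : Set X), gradNorm D.h φ₀ x ^ 2 ∂μ := by
    filter_upwards [eventually_gt_atTop (R₁ + 1)] with ρ hρ
    have hρR : e.R < ρ := by linarith
    have hρ0 : 0 < ρ := e.R_pos.trans hρR
    have hχs : ContMDiff (𝓡 3) 𝓘(ℝ, ℝ) ∞ (fun q ↦ χ (‖e.coord q‖ / ρ)) :=
      e.contMDiff_radialCutoff hχ h1 hρR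
    -- the comparison function `1 - χ_ρ`
    have hφρs : ContMDiff (𝓡 3) 𝓘(ℝ, ℝ) ∞ (fun q ↦ 1 - χ (‖e.coord q‖ / ρ)) :=
      contMDiff_const.sub hχs
    have hφρ0 : ∀ q, q ∉ ((↑) : e.U → X) '' (e.chart ⁻¹' {x | ρ ≤ ‖(x : E3)‖}) →
        (fun q ↦ 1 - χ (‖e.coord q‖ / ρ)) =ᶠ[𝓝 q] fun _ ↦ 0 := fun q hq ↦ by
      filter_upwards [e.radialCutoff_eventuallyEq_one h1 hρR hq] with p hp
      have hp' : χ (‖e.coord p‖ / ρ) = 1 := hp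
      rw [hp', sub_self]
    have hφρU : tsupport (fun q ↦ 1 - χ (‖e.coord q‖ / ρ)) ⊆ (U : Set X) := by
      refine (closure_minimal (fun q hq ↦ ?_) (e.isClosed_far ρ hρR)).trans fun q hq ↦ ?_
      · by_contra hq'
        exact hq (hφρ0 q hq').eq_of_nhds
      · obtain ⟨hqU, hqR⟩ := e.mem_image_preimage_le_norm_iff.1 hq
        exact hfarU (e.mem_far_iff_coord.2 ⟨hqU, by linarith⟩)
    have hφρ1 : ∀ q ∈ e.far (2 * ρ), (fun q ↦ 1 - χ (‖e.coord q‖ / ρ)) q = 1 := fun q hq ↦ by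
      simp only [e.radialCutoff_eq_zero_of_mem_far h2 hρ0 hq, sub_zero]
    have hpair := integral_pairing_eq_setIntegral_of_harmonic D.h hU hφ₀ hΔ h01 hfin hφρs
      hφρU hφρ1
    -- pointwise: `h⁻¹(dχ_ρ, df) = -h⁻¹(d(1 - χ_ρ), dφ₀)`
    have hpt : ∀ x, D.metric.innerDual x
        (mvfderiv (𝓡 3) (fun q ↦ χ (‖e.coord q‖ / ρ)) x).toLinearMap
        (mvfderiv (𝓡 3) f x).toLinearMap =
        -(PseudoRiemannianMetric.ofRiemannian D.h).innerDual x
          (mvfderiv (𝓡 3) (fun q ↦ 1 - χ (‖e.coord q‖ / ρ)) x).toLinearMap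
          (mvfderiv (𝓡 3) φ₀ x).toLinearMap := fun x ↦ by
      by_cases hx : x ∈ ((↑) : e.U → X) '' (e.chart ⁻¹' {x | ρ ≤ ‖(x : E3)‖})
      · obtain ⟨hxU, hxR⟩ := e.mem_image_preimage_le_norm_iff.1 hx
        have hxfar : x ∈ e.far (R₁ + 1) := e.mem_far_iff_coord.2 ⟨hxU, by linarith⟩
        have hd : mvfderiv (𝓡 3) (fun q ↦ 1 - χ (‖e.coord q‖ / ρ)) x =
            -mvfderiv (𝓡 3) (fun q ↦ χ (‖e.coord q‖ / ρ)) x := by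
          rw [mvfderiv_fun_sub mdifferentiableAt_const ((hχs x).mdifferentiableAt (by simp)),
            mvfderiv_const, zero_sub]
        rw [mvfderiv_congr_of_eventuallyEq (hfφ' x hxfar), hd, ContinuousLinearMap.toLinearMap_neg,
          show ∀ (α β : Module.Dual ℝ (TangentSpace (𝓡 3) x)),
            (PseudoRiemannianMetric.ofRiemannian D.h).innerDual x (-α) β =
              -(PseudoRiemannianMetric.ofRiemannian D.h).innerDual x α β from fun α β ↦ by
            simp [PseudoRiemannianMetric.innerDual], neg_neg]
        rfl
      · rw [e.mvfderiv_radialCutoff_eq_zero h1 hρR hx,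
          PseudoRiemannianMetric.mvfderiv_eq_zero_of_eventuallyEq_zero (hφρ0 x hx)]
        simp [PseudoRiemannianMetric.innerDual]
    simp_rw [hpt]
    rw [integral_neg, hpair]
  -- (5) conclusion: an eventually constant sequence with limit `4π(-c)`
  have hlim2 : Tendsto (fun ρ : ℝ ↦ ∫ x, D.metric.innerDual x
      (mvfderiv (𝓡 3) (fun q ↦ χ (‖e.coord q‖ / ρ)) x).toLinearMap
      (mvfderiv (𝓡 3) f x).toLinearMap ∂μ) atTop
        (𝓝 (-∫ x in (U : Set X), gradNorm D.h φ₀ x ^ 2 ∂μ)) :=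
    tendsto_const_nhds.congr' (hconst.mono fun ρ h ↦ h.symm)
  have heq := tendsto_nhds_unique hflux hlim2
  linarith

/-- **`ℰ(Σ, g) = 2c` for the harmonic potential `φ₀ = 1 - c/|x| + O₁(|x|⁻²)`** (Bray 2001, §6,
(87): "`φ(x) = 1 − ℰ(Σ, g)/(2|x|) + O(1/|x|²)`", i.e. the capacity of Def. 17 is twice the
monopole coefficient of its Green's function (86)). Under the hypotheses of
`setIntegral_gradNorm_sq_eq_of_harmonic_of_expansion`:
`horizonCapacity D.h e U = 2c` (`= (1/2π) ∫_U |∇φ₀|² = (1/2π) · 4πc`,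
`horizonCapacity_eq_of_harmonic`). [cite: BrayRPI2001, §6 (86)–(87)] -/
theorem horizonCapacity_eq_ofReal_of_harmonic_of_expansion {α : ℝ} (hα : 0 < α)
    (hAF : e.IsMetricAsymptoticallyFlat D α) (hU : IsExteriorRegion e U) {φ₀ : X → ℝ}
    (hφ₀ : IsCapacityTestFn e U φ₀)
    (hΔ : ∀ x ∈ (U : Set X), D.metric.dalembertian φ₀ x = 0)
    (h01 : ∀ x ∈ (U : Set X), 0 < φ₀ x ∧ φ₀ x < 1)
    (hfin : ∫⁻ x in (U : Set X), ENNReal.ofReal (gradNorm D.h φ₀ x ^ 2) ∂riemannianMeasure D.h < ⊤)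
    {c : ℝ}
    (hexp : (fun x : E3 ↦ ‖fderiv ℝ (fun y ↦ endValue e φ₀ y - (1 - c / ‖y‖)) x‖)
      =O[cobounded E3] fun x ↦ ‖x‖ ^ (-3 : ℝ)) :
    horizonCapacity D.h e U = ENNReal.ofReal (2 * c) := by
  haveI : (PseudoRiemannianMetric.ofRiemannian D.h).HasLeviCivita := ‹D.metric.HasLeviCivita›
  have hE := setIntegral_gradNorm_sq_eq_of_harmonic_of_expansion D hα hAF hU hφ₀ hΔ h01 hfin hexp
  have htop : horizonCapacity D.h e U ≠ ⊤ := by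
    rw [horizonCapacity_eq_of_harmonic D.h hU hφ₀ hΔ h01 hfin]
    exact ENNReal.mul_ne_top ENNReal.ofReal_ne_top hfin.ne
  have hreal := horizonCapacity_toReal_eq_of_harmonic D.h hU hφ₀ hΔ h01 hfin
  rw [hE] at hreal
  have h2c : (horizonCapacity D.h e U).toReal = 2 * c := by
    rw [hreal]
    field_simp
    ring
  rw [← ENNReal.ofReal_toReal htop, h2c]

/-- **`½ ℰ(Σ, g) = c`**, the left-hand side of Bray's Theorem 9 (`m ≥ ½ ℰ(Σ, g)`, the named
fact `Bray2001_mass_ge_half_capacity`) in terms of the monopole coefficient of the harmonic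
potential: under the hypotheses of `setIntegral_gradNorm_sq_eq_of_harmonic_of_expansion`,
`(horizonCapacity D.h e U).toReal / 2 = c`; in particular `0 ≤ c`. Thus Thm. 9 for such data is
the statement `m ≥ c` for `φ₀ = 1 − c/|x| + O₁(|x|⁻²)`, which Bray obtains from Thm. 8 (the
positive mass theorem for the doubled manifold). [cite: BrayRPI2001, §6 (87) and Thm. 9] -/
theorem horizonCapacity_toReal_div_two_eq_of_harmonic_of_expansion {α : ℝ} (hα : 0 < α)
    (hAF : e.IsMetricAsymptoticallyFlat D α) (hU : IsExteriorRegion e U) {φ₀ : X → ℝ}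
    (hφ₀ : IsCapacityTestFn e U φ₀)
    (hΔ : ∀ x ∈ (U : Set X), D.metric.dalembertian φ₀ x = 0)
    (h01 : ∀ x ∈ (U : Set X), 0 < φ₀ x ∧ φ₀ x < 1)
    (hfin : ∫⁻ x in (U : Set X), ENNReal.ofReal (gradNorm D.h φ₀ x ^ 2) ∂riemannianMeasure D.h < ⊤)
    {c : ℝ}
    (hexp : (fun x : E3 ↦ ‖fderiv ℝ (fun y ↦ endValue e φ₀ y - (1 - c / ‖y‖)) x‖)
      =O[cobounded E3] fun x ↦ ‖x‖ ^ (-3 : ℝ)) :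
    (horizonCapacity D.h e U).toReal / 2 = c ∧ 0 ≤ c := by
  haveI : (PseudoRiemannianMetric.ofRiemannian D.h).HasLeviCivita := ‹D.metric.HasLeviCivita›
  have hE := setIntegral_gradNorm_sq_eq_of_harmonic_of_expansion D hα hAF hU hφ₀ hΔ h01 hfin hexp
  have hreal := horizonCapacity_toReal_eq_of_harmonic D.h hU hφ₀ hΔ h01 hfin
  rw [hE] at hreal
  have h2c : (horizonCapacity D.h e U).toReal = 2 * c := by
    rw [hreal]
    field_simp
    ring
  refine ⟨by rw [h2c]; ring, ?_⟩
  have h0 : 0 ≤ (horizonCapacity D.h e U).toReal := ENNReal.toReal_nonneg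
  linarith

/-- **`½ ℰ(Σ, g) = c` under the hypotheses of `Bray2001_mass_ge_half_capacity`**: for
time-symmetric data whose chosen end `e` is asymptotically flat of order `1` (Bray's Def. 21) and
a horizon `Σ ∈ 𝒮` with outside region `U` (`IsOutsideOf e U f' ν'`), if the capacity potential
`φ₀` of `Σ` (a test function, `h`-harmonic with `0 < φ₀ < 1` on `U`, of finite energy) has the
expansion `φ₀ ∘ Φ = 1 − c/r + O₁(r⁻²)` of (87), then the left-hand side of Thm. 9 is
`(horizonCapacity D.h e U).toReal / 2 = c` (and `c ≥ 0`). [cite: BrayRPI2001, §6 (87) and Thm. 9] -/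
theorem IsOutsideOf.horizonCapacity_toReal_div_two_eq {S' : Type*} {f' : S' → X}
    {ν' : NormalField (𝓡 3) f'} (hAF : e.IsAsymptoticallyFlat D 1) (hU : IsOutsideOf e U f' ν')
    {φ₀ : X → ℝ} (hφ₀ : IsCapacityTestFn e U φ₀)
    (hΔ : ∀ x ∈ (U : Set X), D.metric.dalembertian φ₀ x = 0)
    (h01 : ∀ x ∈ (U : Set X), 0 < φ₀ x ∧ φ₀ x < 1)
    (hfin : ∫⁻ x in (U : Set X), ENNReal.ofReal (gradNorm D.h φ₀ x ^ 2) ∂riemannianMeasure D.h < ⊤)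
    {c : ℝ}
    (hexp : (fun x : E3 ↦ ‖fderiv ℝ (fun y ↦ endValue e φ₀ y - (1 - c / ‖y‖)) x‖)
      =O[cobounded E3] fun x ↦ ‖x‖ ^ (-3 : ℝ)) :
    (horizonCapacity D.h e U).toReal / 2 = c ∧ 0 ≤ c :=
  horizonCapacity_toReal_div_two_eq_of_harmonic_of_expansion D one_pos
    hAF.isMetricAsymptoticallyFlat hU.isExteriorRegion hφ₀ hΔ h01 hfin hexp

end Capacity

end Literature.Geometry.Lorentzian

end
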